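import Summits.KontsevichZagierPeriods.KontsevichZagierPeriods.Theorems.TerasomaMultiplicationBetaCancellationStubPiMulFibred
import Summits.KontsevichZagierPeriods.KontsevichZagierPeriods.Theorems.TerasomaMultiplicationBetaCancellationOfAyoubPiCancellation

/-!
# Crux stmt-KontsevichZagierPeriods-0540 (`LiouvilleUnfolding.AyoubPiCancellation` ≡
# `KZ.PiCancellation`), line `Sketch` (`moving-segment-wronskian`): stub `stub_exteriorAnnihilation`

Support file (`--supports` stmt-KontsevichZagierPeriods-0540) of the line skeleton, registered stub
`stub_exteriorAnnihilation` (M, side theorem, the unconditional EXTERIOR case of (B)): for wall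
positions `q ∈ (a, b)`, `1 ≤ a < b`, the moving segment `D ∩ {z₀ < q}` is the whole disc
(`z₀ ≤ 1 ≤ a < q`), so the pinned spread family
`V n r = [{(q, z₀, z₁, w) : a < q < b, z₀² + z₁² ≤ 1, z₀ < q, w ∈ σ_r}, g_r(w)]` IS the interval
prepend `Q (n + 2) (P n r)` (`KZ.IntegralRep.ext'`) of the pinned disc family `P` of item 0540,
`Q m t = [(a, b) × σ_t, g_t ∘ tail]` (`extAnn_exists_prepend`, a reindexed product). Hence
`lift (of ∘ V) c = lift (of ∘ Q) (lift (of ∘ P) c)` (`FreeAbelianGroup.lift_unique`), the inner term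
is a relation iff `[π] * c` is (`BetaCancellationLine.lift_mem_relations_iff`), and the MAIN LEMMA
`extAnn_lift_mem_fibredRelations` (interval analogue of `BetaCancellationLine.stub_piMulFibred`):
`lift (of ∘ Q)` maps `KZ.relations` into the `q`-FIBRED relations `KZ.fibredRelations`
(`AddSubgroup.closure_le`; generatorwise [Kontsevich–Zagier 2001, §1.2 rules (1)–(3)]: additivity
one dimension up, `extAnn_domainAdd`, `extAnn_integrandAdd`; `Φ ↦ Ψ z = (z₀, Φ (tail z))`,
`Ψ z 0 = z 0`, a FIBRED change of variables, `extAnn_changeOfVariables`; Newton–Leibniz over a base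
of dimension `k` ↦ a FIBRED Newton–Leibniz move over the base `Q k r'` of dimension `k + 1 ≥ 1`,
`extAnn_newtonLeibniz`). No definitions, no sorry; axioms ⊆ {propext, Classical.choice, Quot.sound}.
References: M. Kontsevich, D. Zagier, *Periods* (2001), §1.2, §4.1; J. Ayoub, *Une version relative
de la conjecture des périodes de Kontsevich–Zagier*, Ann. of Math. 181 (2015), §1.
-/

noncomputable section

-- `Summit.KontsevichZagierPeriods.KontsevichZagierPeriods.…` is the tree's mandated layout (single-conjunct summit).
set_option linter.dupNamespace false

namespace Summit.KontsevichZagierPeriods.KontsevichZagierPeriods.AyoubPiCancellationLine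

open Set MeasureTheory
open Literature.NumberTheory.Transcendental
open Literature.NumberTheory.Transcendental.KZ
open Literature.ModelTheory.ExponentialFields (IsSemialgebraic)
open MvPolynomial (X)
open Summit.KontsevichZagierPeriods.KontsevichZagierPeriods.BetaCancellationLine
  (piMulFib_volume_setOf_comp_equiv exists_pinned lift_mem_relations_iff)

variable {k : ℕ}

/-! ### §1 The tail `z ↦ (z₁, …, z_k)` of `ℝ^{k+1}` (interval coordinate `z₀` in front) -/

/-- The relabelling `Fin (1 + n) ≃ Fin (n + 1)` on the interval coordinate. [folklore] -/
theorem extAnn_idx_castAdd_zero (n : ℕ) :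
    (finCongr (Nat.add_comm 1 n) (Fin.castAdd n (0 : Fin 1)) : Fin (n + 1)) = 0 :=
  Fin.ext (by simp)

/-- The relabelling `Fin (1 + n) ≃ Fin (n + 1)` on the trailing coordinates. [folklore] -/
theorem extAnn_idx_natAdd (n : ℕ) (j : Fin n) :
    (finCongr (Nat.add_comm 1 n) (Fin.natAdd 1 j) : Fin (n + 1)) = j.succ :=
  Fin.ext (by simp only [finCongr_apply_coe, Fin.val_natAdd, Fin.val_succ]; omega)

/-- **The cylinder over a null set of the tail is null**: `vol (ℝ × N) = ∞ · 0 = 0`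
(`KZ.volume_cylinder` transported along `Fin (1 + k) ≃ Fin (k + 1)`). [folklore] -/
theorem extAnn_volume_setOf_tail_mem {N : Set (Fin k → ℝ)} (hN : volume N = 0) :
    volume {z : Fin (k + 1) → ℝ | (fun i : Fin k => z i.succ) ∈ N} = 0 := by
  have hC : {z : Fin (k + 1) → ℝ | (fun i : Fin k => z i.succ) ∈ N} =
      {w : Fin (k + 1) → ℝ | (fun i => w (finCongr (Nat.add_comm 1 k) i)) ∈
        {z : Fin (1 + k) → ℝ | (fun i => z (Fin.castAdd k i)) ∈ (univ : Set (Fin 1 → ℝ)) ∧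
          (fun j => z (Fin.natAdd 1 j)) ∈ N}} := by
    ext w; simp only [mem_setOf_eq, mem_univ, true_and, extAnn_idx_natAdd]
  rw [hC, piMulFib_volume_setOf_comp_equiv, volume_cylinder, hN, mul_zero]

/-- The tail projection `ℝ^{k+1} → ℝᵏ` is a `ℚ`-semialgebraic (coordinate) map on every
`ℚ`-semialgebraic set. [folklore] -/
theorem extAnn_isSemialgebraicMapOn_tail {S : Set (Fin (k + 1) → ℝ)} (hS : IsSemialgebraic ℚ S) :
    IsSemialgebraicMapOn ℚ S (fun z : Fin (k + 1) → ℝ => fun i : Fin k => z i.succ) := by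
  convert isSemialgebraicMapOn_aeval hS (fun i : Fin k => (X i.succ : MvPolynomial (Fin (k + 1)) ℚ))
    using 2 with z
  ext i; simp

/-- A `ℚ`-semialgebraic function of the tail, `z ↦ G (z₁, …, z_k)`, is `ℚ`-semialgebraic on every
`ℚ`-semialgebraic set whose tails lie in the domain of `G` (Tarski–Seidenberg). [folklore] -/
theorem extAnn_isSemialgebraicFunOn_comp_tail {S : Set (Fin (k + 1) → ℝ)} {B : Set (Fin k → ℝ)}
    {G : (Fin k → ℝ) → ℝ} (hS : IsSemialgebraic ℚ S) (hG : IsSemialgebraicFunOn ℚ B G)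
    (hSB : ∀ z ∈ S, (fun i : Fin k => z i.succ) ∈ B) :
    IsSemialgebraicFunOn ℚ S (fun z => G (fun i : Fin k => z i.succ)) :=
  IsSemialgebraicFunOn.comp_isSemialgebraicMapOn_holds hG (extAnn_isSemialgebraicMapOn_tail hS) hSB

/-- On `ℝ^{(k+1)+1}`: dropping the last coordinate does not touch coordinate `0`. [folklore] -/
theorem extAnn_init_apply_zero (z : Fin (k + 1 + 1) → ℝ) : Fin.init z 0 = z 0 := rfl

/-- On `ℝ^{(k+1)+1}`: the tail commutes with dropping the last coordinate. [folklore] -/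
theorem extAnn_init_tail (z : Fin (k + 1 + 1) → ℝ) :
    Fin.init (fun i : Fin (k + 1) => z i.succ) = fun i : Fin k => Fin.init z i.succ := rfl

/-- On `ℝ^{(k+1)+1}`: the last coordinate of the tail is the last coordinate. [folklore] -/
theorem extAnn_tail_last (z : Fin (k + 1 + 1) → ℝ) :
    z (Fin.last k).succ = z (Fin.last (k + 1)) := rfl

/-- On `ℝ^{(k+1)+1}`: the tail of `(x, t)` is `((x₁, …), t)`. [folklore] -/
theorem extAnn_tail_snoc (x : Fin (k + 1) → ℝ) (t : ℝ) :
    (fun i : Fin (k + 1) => (Fin.snoc x t : Fin (k + 1 + 1) → ℝ) i.succ) =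
      Fin.snoc (fun i : Fin k => x i.succ) t := by
  ext i
  refine Fin.lastCases ?_ (fun j => ?_) i <;>
    simp only [Fin.succ_last, Fin.snoc_last, Fin.succ_castSucc, Fin.snoc_castSucc]

/-! ### §2 The four moves under a pinned interval prepend `Q m t = [(a, b) × σ_t, g_t ∘ tail]` -/

section Generators

variable {a b : ℚ} {Q : ∀ n : ℕ, IntegralRep n → IntegralRep (n + 1)}
  (hQ : ∀ (n : ℕ) (r : IntegralRep n),
    (Q n r).domain = {z : Fin (n + 1) → ℝ | ((a : ℝ) < z 0 ∧ z 0 < b) ∧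
      (fun i : Fin n => z i.succ) ∈ r.domain} ∧
    (Q n r).integrand = fun z => r.integrand (fun i : Fin n => z i.succ))
include hQ

/-- **Interval × (domain additivity) is domain additivity** (overlap inside the cylinder over the
null set `σ₁ ∩ σ₂`). [cite: KontsevichZagier2001, §1.2 rule (1)] -/
theorem extAnn_domainAdd {r r₁ r₂ : IntegralRep k} (hdom : r.domain = r₁.domain ∪ r₂.domain)
    (hnull : volume (r₁.domain ∩ r₂.domain) = 0) (h₁ : EqOn r.integrand r₁.integrand r₁.domain)
    (h₂ : EqOn r.integrand r₂.integrand r₂.domain) :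
    of (Q k r) - of (Q k r₁) - of (Q k r₂) ∈ domainAddRel := by
  obtain ⟨⟨hD, hI⟩, ⟨hD₁, hI₁⟩, ⟨hD₂, hI₂⟩⟩ := And.intro (hQ k r) (And.intro (hQ k r₁) (hQ k r₂))
  refine ⟨k + 1, Q k r, Q k r₁, Q k r₂, ?_, ?_, ?_, ?_, rfl⟩
  · rw [hD, hD₁, hD₂]; ext z
    simp only [hdom, mem_union, mem_setOf_eq]
    tauto
  · refine measure_mono_null (fun z hz => ?_) (extAnn_volume_setOf_tail_mem hnull)
    rw [hD₁, hD₂] at hz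
    exact ⟨hz.1.2, hz.2.2⟩
  · intro z hz
    rw [hD₁] at hz; rw [hI, hI₁]
    exact h₁ hz.2
  · intro z hz
    rw [hD₂] at hz; rw [hI, hI₂]
    exact h₂ hz.2

/-- **Interval × (integrand additivity) is integrand additivity.**
[cite: KontsevichZagier2001, §1.2 rule (1)] -/
theorem extAnn_integrandAdd {r r₁ r₂ : IntegralRep k} (h₁ : r₁.domain = r.domain)
    (h₂ : r₂.domain = r.domain) (hadd : EqOn r.integrand (r₁.integrand + r₂.integrand) r.domain) :
    of (Q k r) - of (Q k r₁) - of (Q k r₂) ∈ integrandAddRel := by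
  obtain ⟨⟨hD, hI⟩, ⟨hD₁, hI₁⟩, ⟨hD₂, hI₂⟩⟩ := And.intro (hQ k r) (And.intro (hQ k r₁) (hQ k r₂))
  refine ⟨k + 1, Q k r, Q k r₁, Q k r₂, ?_, ?_, ?_, rfl⟩
  · rw [hD₁, hD, h₁]
  · rw [hD₂, hD, h₂]
  · intro z hz
    rw [hD] at hz; rw [hI, hI₁, hI₂]
    exact hadd hz.2

/-- **Interval × (change of variables) is a FIBRED change of variables**: `Ψ z = (z₀, Φ (tail z))`
on `(a, b) × σ`, derivative `id × Φ'` within it (chain rule through `ℝ × ℝᵏ ≃ ℝ^{k+1}`), injective,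
image `(a, b) × Φ '' σ`, `|det Ψ'| = |det Φ'|` (`LinearMap.det_conj`, `LinearMap.det_prodMap`), and
`Ψ z 0 = z 0`. [cite: KontsevichZagier2001, §1.2 rule (2)] -/
theorem extAnn_changeOfVariables {r r' : IntegralRep k} {Φ : (Fin k → ℝ) → (Fin k → ℝ)}
    {Φ' : (Fin k → ℝ) → (Fin k → ℝ) →L[ℝ] (Fin k → ℝ)} (hΦ : IsSemialgebraicMapOn ℚ r.domain Φ)
    (hΦ' : ∀ x ∈ r.domain, HasFDerivWithinAt Φ (Φ' x) r.domain x) (hinj : InjOn Φ r.domain)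
    (hdom : r'.domain = Φ '' r.domain)
    (hf : ∀ x ∈ r.domain, r.integrand x = r'.integrand (Φ x) * |(Φ' x).det|) :
    of (Q k r) - of (Q k r') ∈ fibredChangeOfVariablesRel := by
  obtain ⟨⟨hD, hI⟩, ⟨hD', hI'⟩⟩ := And.intro (hQ k r) (hQ k r')
  -- the linear identification `ℝ × ℝᵏ ≃ ℝ^{k+1}` (interval coordinate first), `Ψ` and `Ψ'`
  let e : (ℝ × (Fin k → ℝ)) ≃ₗ[ℝ] (Fin (k + 1) → ℝ) :=
    { toFun := fun p => Fin.cons p.1 p.2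
      invFun := fun z => (z 0, fun i => z i.succ)
      map_add' := fun p q => by ext j; refine Fin.cases ?_ (fun i => ?_) j <;> simp
      map_smul' := fun c p => by ext j; refine Fin.cases ?_ (fun i => ?_) j <;> simp
      left_inv := fun p => by ext <;> simp
      right_inv := fun z => by ext j; refine Fin.cases ?_ (fun i => ?_) j <;> simp }
  let eL : (ℝ × (Fin k → ℝ)) ≃L[ℝ] (Fin (k + 1) → ℝ) := e.toContinuousLinearEquiv
  have heL_symm : ∀ z, eL.symm z = (z 0, fun i => z i.succ) := fun z => rfl
  let Ψ : (Fin (k + 1) → ℝ) → (Fin (k + 1) → ℝ) := eL ∘ Prod.map id Φ ∘ eL.symm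
  let Ψ' : (Fin (k + 1) → ℝ) → (Fin (k + 1) → ℝ) →L[ℝ] (Fin (k + 1) → ℝ) := fun z =>
    (eL : _ →L[ℝ] _).comp ((((ContinuousLinearMap.id ℝ ℝ).prodMap
      (Φ' (fun i => z i.succ))).comp (eL.symm : _ →L[ℝ] _)))
  have hΨ : ∀ z, Ψ z = Fin.cons (z 0) (Φ fun i => z i.succ) := fun z => rfl
  have hΨ0 : ∀ z, Ψ z 0 = z 0 := fun z => by rw [hΨ, Fin.cons_zero]
  have hΨs : ∀ z (i : Fin k), Ψ z i.succ = Φ (fun i => z i.succ) i := fun z i => by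
    rw [hΨ, Fin.cons_succ]
  have hdet : ∀ z, (Ψ' z).det = (Φ' (fun i => z i.succ)).det := by
    intro z
    have hcoe : (Ψ' z : (Fin (k + 1) → ℝ) →ₗ[ℝ] (Fin (k + 1) → ℝ)) =
        (e : (ℝ × (Fin k → ℝ)) →ₗ[ℝ] (Fin (k + 1) → ℝ)) ∘ₗ
          ((LinearMap.id : ℝ →ₗ[ℝ] ℝ).prodMap
            (Φ' (fun i => z i.succ) : (Fin k → ℝ) →ₗ[ℝ] (Fin k → ℝ))) ∘ₗ
          (e.symm : (Fin (k + 1) → ℝ) →ₗ[ℝ] (ℝ × (Fin k → ℝ))) :=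
      LinearMap.ext fun v => rfl
    change LinearMap.det _ = LinearMap.det _
    rw [hcoe, LinearMap.det_conj, LinearMap.det_prodMap, LinearMap.det_id, one_mul]
  have hS : (Q k r).domain = eL.symm ⁻¹' (Ioo (a : ℝ) b ×ˢ r.domain) := by
    ext z
    simp only [hD, mem_preimage, heL_symm, mem_prod, mem_setOf_eq, mem_Ioo]
  have hmaps : ∀ z ∈ (Q k r).domain, (fun i : Fin k => z i.succ) ∈ r.domain := fun z hz => by
    rw [hD] at hz; exact hz.2
  refine ⟨k, Q k r, Q k r', Ψ, Ψ', ?_, ?_, ?_, ?_, ?_, ?_, rfl⟩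
  · -- semialgebraic, coordinatewise
    refine IsSemialgebraicMapOn.of_forall (Q k r).isSemialgebraic_domain fun j => ?_
    refine Fin.cases ?_ (fun i => ?_) j
    · simp only [hΨ0]
      convert isSemialgebraicFunOn_aeval (Q k r).isSemialgebraic_domain
        (X 0 : MvPolynomial (Fin (k + 1)) ℚ) using 2 with z
      simp
    · simp only [hΨs]
      exact extAnn_isSemialgebraicFunOn_comp_tail (Q k r).isSemialgebraic_domain
        ((isSemialgebraicMapOn_iff_forall_holds r.isSemialgebraic_domain).mp hΦ i) hmaps
  · -- derivative within the cylinder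
    intro z hz
    have hx : (fun i => z i.succ) ∈ r.domain := hmaps z hz
    have hg : HasFDerivWithinAt (Prod.map id Φ)
        ((ContinuousLinearMap.id ℝ ℝ).prodMap (Φ' (fun i => z i.succ)))
        (Ioo (a : ℝ) b ×ˢ r.domain) (eL.symm z) := by
      refine HasFDerivWithinAt.prodMap (eL.symm z) (hasFDerivWithinAt_id _ _) ((hΦ' _ hx).mono ?_)
      rintro _ ⟨q, hq, rfl⟩
      exact hq.2
    have h2 := (eL.comp_hasFDerivWithinAt_iff).mpr hg
    rw [hS]
    exact (eL.symm.comp_right_hasFDerivWithinAt_iff (f := eL ∘ Prod.map id Φ)).mpr h2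
  · -- injective
    intro z₁ hz₁ z₂ hz₂ h
    have h0 : z₁ 0 = z₂ 0 := by rw [← hΨ0 z₁, ← hΨ0 z₂, h]
    have h2 : Φ (fun i => z₁ i.succ) = Φ (fun i => z₂ i.succ) := by
      funext i
      rw [← hΨs z₁, ← hΨs z₂, h]
    have htl := hinj (hmaps z₁ hz₁) (hmaps z₂ hz₂) h2
    funext j
    exact Fin.cases h0 (fun i => congrFun htl i) j
  · -- image
    ext w
    rw [hD', hD, mem_setOf_eq, mem_image]
    constructor
    · rintro ⟨hw, hw'⟩
      rw [hdom] at hw'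
      obtain ⟨x, hx, hwx⟩ := hw'
      refine ⟨Fin.cons (w 0) x, ?_, ?_⟩
      · simp only [mem_setOf_eq, Fin.cons_zero, Fin.cons_succ]
        exact ⟨hw, hx⟩
      · rw [hΨ]
        funext j
        refine Fin.cases (by simp) (fun i => ?_) j
        simp only [Fin.cons_succ]
        exact congrFun hwx i
    · rintro ⟨z, ⟨hz, hz'⟩, rfl⟩
      refine ⟨by rw [hΨ0]; exact hz, ?_⟩
      simp only [hΨs]
      rw [hdom]
      exact mem_image_of_mem Φ hz'
  · -- integrands
    intro z hz
    rw [hI, hI', hdet]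
    simp only [hΨs]
    exact hf _ (hmaps z hz)
  · -- the parameter coordinate is preserved
    exact fun z _ => hΨ0 z

/-- **Interval × (Newton–Leibniz) is a FIBRED Newton–Leibniz move**: the band over `r'.domain ⊆ ℝᵏ`
prepended with the interval is the band over the base `(a, b) × r'.domain ⊆ ℝ^{k+1}` (dimension
`≥ 1`) with bounds `α ∘ tail ≤ β ∘ tail` and primitive `F ∘ tail`.
[cite: KontsevichZagier2001, §1.2 rule (3)] -/
theorem extAnn_newtonLeibniz {r : IntegralRep (k + 1)} {r' : IntegralRep k}
    {α β : (Fin k → ℝ) → ℝ} {F : (Fin (k + 1) → ℝ) → ℝ} (hF : IsSemialgebraicFunOn ℚ r.domain F)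
    (hα : IsSemialgebraicFunOn ℚ r'.domain α) (hβ : IsSemialgebraicFunOn ℚ r'.domain β)
    (hle : ∀ x ∈ r'.domain, α x ≤ β x)
    (hdom : r.domain = {z | (Fin.init z : Fin k → ℝ) ∈ r'.domain ∧
      α (Fin.init z) ≤ z (Fin.last k) ∧ z (Fin.last k) ≤ β (Fin.init z)})
    (hcont : ∀ x ∈ r'.domain, ContinuousOn (fun t : ℝ => F (Fin.snoc x t)) (Icc (α x) (β x)))
    (hderiv : ∀ x ∈ r'.domain, ∀ t ∈ Ioo (α x) (β x),
      HasDerivAt (fun s : ℝ => F (Fin.snoc x s)) (r.integrand (Fin.snoc x t)) t)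
    (hr' : ∀ x ∈ r'.domain, r'.integrand x = F (Fin.snoc x (β x)) - F (Fin.snoc x (α x))) :
    of (Q (k + 1) r) - of (Q k r') ∈ fibredNewtonLeibnizRel := by
  obtain ⟨⟨hD, hI⟩, ⟨hD', hI'⟩⟩ := And.intro (hQ (k + 1) r) (hQ k r')
  have hD3 : ∀ z : Fin (k + 1 + 1) → ℝ, z ∈ (Q (k + 1) r).domain ↔
      ((a : ℝ) < z 0 ∧ z 0 < b) ∧ (fun i : Fin (k + 1) => z i.succ) ∈ r.domain := fun z => by
    rw [hD]; rfl
  have hmaps' : ∀ w ∈ (Q k r').domain, (fun i : Fin k => w i.succ) ∈ r'.domain := fun w hw => by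
    rw [hD'] at hw; exact hw.2
  refine of_sub_of_mem_fibredNewtonLeibnizRel ⟨k + 1, Q (k + 1) r, Q k r',
    fun w => α (fun i => w i.succ), fun w => β (fun i => w i.succ),
    fun z => F (fun i => z i.succ), ?_, ?_, ?_, ?_, ?_, ?_, ?_, ?_, rfl⟩
  · exact extAnn_isSemialgebraicFunOn_comp_tail (Q (k + 1) r).isSemialgebraic_domain hF
      (fun z hz => ((hD3 z).mp hz).2)
  · exact extAnn_isSemialgebraicFunOn_comp_tail (Q k r').isSemialgebraic_domain hα hmaps'
  · exact extAnn_isSemialgebraicFunOn_comp_tail (Q k r').isSemialgebraic_domain hβ hmaps'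
  · exact fun w hw => hle _ (hmaps' w hw)
  · ext z; rw [hD3]
    simp only [mem_setOf_eq, hD', hdom, extAnn_init_apply_zero, extAnn_init_tail, extAnn_tail_last]
    tauto
  · intro w hw
    simp only [extAnn_tail_snoc]
    exact hcont _ (hmaps' w hw)
  · intro w hw t ht
    simp only [hI, extAnn_tail_snoc]
    exact hderiv _ (hmaps' w hw) t ht
  · intro w hw
    rw [hI']
    simp only [extAnn_tail_snoc]
    exact hr' _ (hmaps' w hw)

end Generators

/-- **MAIN LEMMA (interval prepends of relations are fibred relations)**: for every pinned
interval-prepend family `Q`, `FreeAbelianGroup.lift (of ∘ Q)` maps `KZ.relations` into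
`KZ.fibredRelations` (`AddSubgroup.closure_le`, generatorwise `extAnn_domainAdd`,
`extAnn_integrandAdd`, `extAnn_changeOfVariables`, `extAnn_newtonLeibniz`). [folklore] -/
theorem extAnn_lift_mem_fibredRelations {a b : ℚ} (Q : ∀ n : ℕ, IntegralRep n → IntegralRep (n + 1))
    (hQ : ∀ (n : ℕ) (r : IntegralRep n),
      (Q n r).domain = {z : Fin (n + 1) → ℝ | ((a : ℝ) < z 0 ∧ z 0 < b) ∧
        (fun i : Fin n => z i.succ) ∈ r.domain} ∧
      (Q n r).integrand = fun z => r.integrand (fun i : Fin n => z i.succ))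
    {c : FormalRep} (hc : c ∈ relations) :
    FreeAbelianGroup.lift (fun s : (Σ n, IntegralRep n) => of (Q s.1 s.2)) c ∈ fibredRelations := by
  have hL : ∀ {m : ℕ} (s : IntegralRep m),
      FreeAbelianGroup.lift (fun s : (Σ n, IntegralRep n) => of (Q s.1 s.2)) (of s) = of (Q m s) :=
    fun s => FreeAbelianGroup.lift_apply_of _ _
  refine (AddSubgroup.closure_le (fibredRelations.comap
    (FreeAbelianGroup.lift (fun s : (Σ n, IntegralRep n) => of (Q s.1 s.2))))).mpr ?_ hc
  rintro g (((hg | hg) | hg) | hg)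
  · obtain ⟨k, r, r₁, r₂, hdom, hnull, h₁, h₂, rfl⟩ := hg
    rw [AddSubgroup.coe_comap, mem_preimage, map_sub, map_sub, hL, hL, hL]
    exact mem_fibredRelations_of_mem_domainAddRel (extAnn_domainAdd hQ hdom hnull h₁ h₂)
  · obtain ⟨k, r, r₁, r₂, h₁, h₂, hadd, rfl⟩ := hg
    rw [AddSubgroup.coe_comap, mem_preimage, map_sub, map_sub, hL, hL, hL]
    exact mem_fibredRelations_of_mem_integrandAddRel (extAnn_integrandAdd hQ h₁ h₂ hadd)
  · obtain ⟨k, r, r', Φ, Φ', hΦ, hΦ', hinj, hdom, hf, rfl⟩ := hg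
    rw [AddSubgroup.coe_comap, mem_preimage, map_sub, hL, hL]
    exact mem_fibredRelations_of_mem_fibredChangeOfVariablesRel
      (extAnn_changeOfVariables hQ hΦ hΦ' hinj hdom hf)
  · obtain ⟨k, r, r', α, β, F, hF, hα, hβ, hle, hband, hcont, hderiv, hr', rfl⟩ := hg
    rw [AddSubgroup.coe_comap, mem_preimage, map_sub, hL, hL]
    exact mem_fibredRelations_of_mem_fibredNewtonLeibnizRel
      (extAnn_newtonLeibniz hQ hF hα hβ hle hband hcont hderiv hr')

/-- **The pinned interval-prepend family exists**: `Q n r := ([(a, b), 1] × r).reindex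
(Fin (1 + n) ≃ Fin (n + 1))`, with `[(a, b), 1] : IntegralRep 1` the rational interval (finite
volume; `KZ.isSemialgebraic_paramSlab`), integrand `1 ⊗ g_r` by
`KZ.IntegralRep.LeftResolves.prod_integrand`. [folklore] -/
theorem extAnn_exists_prepend (a b : ℚ) :
    ∃ Q : ∀ n : ℕ, IntegralRep n → IntegralRep (n + 1), ∀ (n : ℕ) (r : IntegralRep n),
      (Q n r).domain = {z : Fin (n + 1) → ℝ | ((a : ℝ) < z 0 ∧ z 0 < b) ∧
        (fun i : Fin n => z i.succ) ∈ r.domain} ∧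
      (Q n r).integrand = fun z => r.integrand (fun i : Fin n => z i.succ) := by
  have hsub : {x : Fin 1 → ℝ | (a : ℝ) < x 0 ∧ x 0 < b} ⊆ univ.pi fun _ : Fin 1 => Ioo (a : ℝ) b :=
    fun x hx => by simpa only [mem_setOf_eq, mem_univ_pi, Fin.forall_fin_one, mem_Ioo] using hx
  have hvol : volume {x : Fin 1 → ℝ | (a : ℝ) < x 0 ∧ x 0 < b} ≠ ⊤ :=
    ne_top_of_le_ne_top (by rw [Real.volume_pi_Ioo, Fin.prod_univ_one]; exact ENNReal.ofReal_ne_top)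
      (measure_mono hsub)
  have hS := isSemialgebraic_paramSlab 0 a b
  have h1 : IsSemialgebraicFunOn ℚ (paramSlab 0 a b) fun _ => (1 : ℝ) := by
    simpa using isSemialgebraicFunOn_aeval hS (1 : MvPolynomial (Fin 1) ℚ)
  obtain ⟨I, hId, hIi⟩ : ∃ I : IntegralRep 1,
      I.domain = {x : Fin 1 → ℝ | (a : ℝ) < x 0 ∧ x 0 < b} ∧ I.integrand = fun _ => 1 :=
    ⟨⟨_, _, hS, h1, integrableOn_const hvol⟩, rfl, rfl⟩
  refine ⟨fun n r => (I.prod r).reindex (finCongr (Nat.add_comm 1 n)), fun n r => ⟨?_, ?_⟩⟩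
  · ext z
    simp only [IntegralRep.reindex_domain, IntegralRep.prod_domain, IntegralRep.mem_prodDomain,
      mem_setOf_eq, hId, extAnn_idx_castAdd_zero, extAnn_idx_natAdd]
  · funext z
    simp only [IntegralRep.reindex_integrand, (IntegralRep.leftResolves I).prod_integrand r,
      IntegralRep.prodFun_apply, hIi, one_mul, extAnn_idx_natAdd]

/-- **STUB `stub_exteriorAnnihilation`** (M, side theorem — the unconditional EXTERIOR case of (B)):
on an exterior interval of wall positions `1 ≤ a < b` the moving segment `D ∩ {z₀ < q}` is the
whole disc (`z₀ ≤ 1 ≤ a < q`), so the pinned spread family of `c` is the interval prepend of the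
pinned disc family, `V n r = Q (n + 2) (P n r)` (`KZ.IntegralRep.ext'`); hence `lift (of ∘ V) c =
lift (of ∘ Q) (lift (of ∘ P) c)` (`FreeAbelianGroup.lift_unique`), the inner term is a relation
(`BetaCancellationLine.lift_mem_relations_iff`), and `extAnn_lift_mem_fibredRelations` makes the
whole a `q`-fibred relation. [folklore] -/
theorem stub_exteriorAnnihilation : ∀ c : FormalRep, of piRep * c ∈ relations →
    ∀ (a b : ℚ), 1 ≤ a → a < b →
      ∀ (V : ∀ n : ℕ, IntegralRep n → IntegralRep (n + 3)),
        (∀ (n : ℕ) (r : IntegralRep n),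
          (V n r).domain = {z : Fin (n + 3) → ℝ | ((a : ℝ) < z 0 ∧ z 0 < b) ∧ z 1 ^ 2 + z 2 ^ 2 ≤ 1 ∧
            z 1 < z 0 ∧ (fun i : Fin n => z i.succ.succ.succ) ∈ r.domain} ∧
          (V n r).integrand = fun z => r.integrand (fun i : Fin n => z i.succ.succ.succ)) →
        FreeAbelianGroup.lift (fun s : (Σ n, IntegralRep n) => of (V s.1 s.2)) c ∈ fibredRelations := by
  intro c hc a b ha hab V hV
  obtain ⟨P, hP⟩ := exists_pinned
  have hPc := (lift_mem_relations_iff P hP c).2 hc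
  obtain ⟨Q, hQ⟩ := extAnn_exists_prepend a b
  have ha' : (1 : ℝ) ≤ a := by exact_mod_cast ha
  -- the spread family is the interval prepend of the disc family: `z₁ < z₀` is automatic outside
  have hVQ : ∀ (n : ℕ) (r : IntegralRep n), V n r = Q (n + 2) (P n r) := by
    refine fun n r => IntegralRep.ext' ?_ ?_
    · rw [(hV n r).1, (hQ (n + 2) (P n r)).1]
      ext z
      simp only [mem_setOf_eq, (hP n r).1, Fin.succ_zero_eq_one, Fin.succ_one_eq_two]
      refine ⟨fun ⟨hz0, hd, _, hr⟩ => ⟨hz0, hd, hr⟩, fun ⟨hz0, hd, hr⟩ => ⟨hz0, hd, ?_, hr⟩⟩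
      have h1 : z 1 ^ 2 ≤ 1 := by nlinarith [sq_nonneg (z 2)]
      exact (abs_le.mp ((sq_le_one_iff_abs_le_one _).mp h1)).2.trans_lt (ha'.trans_lt hz0.1)
    · rw [(hV n r).2, (hQ (n + 2) (P n r)).2, (hP n r).2]
  -- `lift (of ∘ V) = lift (of ∘ Q) ∘ lift (of ∘ P)` on generators, and the main lemma
  have hlift : ((FreeAbelianGroup.lift fun s : (Σ n, IntegralRep n) => of (Q s.1 s.2)).comp
      (FreeAbelianGroup.lift fun s : (Σ n, IntegralRep n) => of (P s.1 s.2))) c =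
      FreeAbelianGroup.lift (fun s : (Σ n, IntegralRep n) => of (V s.1 s.2)) c := by
    refine FreeAbelianGroup.lift_unique _ _ (fun s => ?_)
    obtain ⟨m, t⟩ := s
    rw [AddMonoidHom.comp_apply, FreeAbelianGroup.lift_apply_of, hVQ m t]
    exact FreeAbelianGroup.lift_apply_of _ _
  rw [← hlift]
  exact extAnn_lift_mem_fibredRelations Q hQ hPc

end Summit.KontsevichZagierPeriods.KontsevichZagierPeriods.AyoubPiCancellationLine
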